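import Mathlib.RingTheory.Smooth.Locus
import Mathlib.RingTheory.RingHom.Smooth
import Mathlib.RingTheory.LocalRing.ResidueField.Ideal
import Literature.AlgebraicGeometry.Resolution.AffineBlowupRegular
import Literature.AlgebraicGeometry.Resolution.RegularCentreLocal
import Literature.AlgebraicGeometry.Resolution.RegularLocusPerfectField
import HarnessLib

/-!
# Blow-up (dilatation) charts of smooth affine schemes at regular centres are smooth
# (crux `IndSmooth.ValuativeSmoothing`, line `birth`, support brick `smooth_blowupChart`)

Support brick for the kernel `stub_pthRootSmoothing` of crux stmt-ResolutionOfSingularities-16087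
(line `birth`, reshape r2). Every strategy for the kernel modifies the smooth chart `T → O` by a
Néron/Zariski DILATATION at the centre: `T` (a smooth finitely generated algebra over the PERFECT
ground field `k`) is replaced by an affine blow-up chart `T[I/a] = (T[It])_{(a t)}` (`a ∈ I`) of
`Bl_I(Spec T) = Proj T[It]` along the centre `I`. This file proves, sorry-free over Mathlib and the
tree, that **these charts are again smooth over `k`**:

* `smooth_of_isRegularRing_of_perfectField`, `isRegularRing_of_smooth`,
  `smooth_iff_isRegularRing_of_perfectField` — ring-level form of Matsumura §30 Remark 2 /
  Stacks 00TV: a finitely generated algebra over a perfect field is smooth iff it is a regular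
  ring (pointwise `isSmoothAt_iff_isRegularLocalRing_of_perfectField` of
  `RegularLocusPerfectField.lean`, globalised by Mathlib's `Algebra.smoothLocus_eq_univ_iff`);
* `finiteType_blowupChart_generator`, `finiteType_blowupChart` — every chart ring
  `(T[It])_{(a t)}`, `a ∈ I`, is of finite type over `k` (the chart at a generator `x_i` of `I` is
  a quotient of `T[X_j : j ≠ i]`, `eval₂Hom_chartGen_surjective`; for a general `a ∈ I` append `a`
  to a finite list of generators);
* `isRegularRing_blowupChart_of_mem` — for `T` regular and `I = (x_1, …, x_r)` with `x`
  quasi-regular and `T/I` regular, EVERY chart ring `(T[It])_{(a t)}`, `a ∈ I` (not only the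
  charts at the generators `x_i t` of `isRegularRing_blowupChart`), is a regular ring: it is an
  affine open of the regular scheme `Bl_I(Spec T)` (`affineBlowup.isRegular_of_isQuasiRegular`,
  `AffineBlowupRegular.lean` — the algebra of Liu, Thm. 8.1.19 (a));
* **`smooth_blowupChart`** (the registered brick) — for `T` smooth over the perfect field `k`,
  `x = (x_1, …, x_r)` quasi-regular in `T` with `T/(x)` a regular ring (a regular centre, e.g. a
  closed point cut out by a regular system of parameters) and any `a ∈ (x)`, the chart ring
  `T[I/a] = (T[It])_{(a t)}` is smooth over `k` (regular + finite type over a perfect field);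
  `smooth_blowupChart_of_isWeaklyRegular` — the same for a `T`-sequence (Rees:
  `isQuasiRegular_of_isWeaklyRegular`);
* `exists_smooth_blowupChart_of_le`, `exists_smooth_blowupChart_of_isMaximal` — the local form
  needed for dilatations at a closed point: if `T/I` is regular (e.g. `I` a maximal ideal) and
  `𝔭 ⊇ I` is a prime, then after shrinking `Spec T` to a basic open neighbourhood `D(h)` of `𝔭`
  the centre is cut out by a quasi-regular sequence `f_1, …, f_c ∈ I`
  (`exists_isQuasiRegular_away_of_isRegularRing`, `RegularCentreLocal.lean`) and ALL the charts
  `(T_h[I_h t])_{(a t)}`, `a ∈ I T_h`, of the blowing up of `T_h = T[1/h]` along `I T_h` are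
  smooth over `k`.

The `k`-algebra structure on a chart ring `B = (T[It])_{(a t)}` is the composite of the structure
map `reesChartBase a ha : T →+* B` (`AffineBlowup.lean`) with `algebraMap k T`; as the chart rings
carry no global `Algebra k` instance, the statements are phrased with Mathlib's `RingHom.Smooth` /
`RingHom.FiniteType`: `((reesChartBase a ha).comp (algebraMap k T)).Smooth` is by definition
`Algebra.Smooth k B` for this `k`-algebra structure (`RingHom.Smooth.toAlgebra`).

Sources: Q. Liu, *Algebraic Geometry and Arithmetic Curves*, OUP 2002, Thm. 8.1.19 (a)
[Liu2002]; H. Matsumura, *Commutative Ring Theory*, CUP 1986, §30 Remark 2 after Thm. 30.3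
[Matsumura1987]; The Stacks Project, Tags 00TV, 052P, 0804.
-/

-- single-problem summit: the doubled namespace component is forced
set_option linter.dupNamespace false

noncomputable section

namespace Summit.ResolutionOfSingularities.ResolutionOfSingularities.Theorems.ValuativeSmoothing

open Literature.AlgebraicGeometry.Resolution HomogeneousLocalization AlgebraicGeometry
  CategoryTheory

universe u

/-! ## Over a perfect field: regular and of finite type ⟺ smooth -/

/-- **A regular finitely generated algebra over a perfect field is smooth** (ring-level form of
Matsumura §30 Remark 2 / Stacks 00TV): `A` is smooth over `k` at every prime
(`isSmoothAt_iff_isRegularLocalRing_of_perfectField`), and a finitely presented algebra whose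
smooth locus is everything is smooth (`Algebra.smoothLocus_eq_univ_iff`).
[cite: Matsumura1987, §30 Remark 2 after Thm. 30.3] -/
theorem smooth_of_isRegularRing_of_perfectField (k A : Type u) [Field k] [PerfectField k]
    [CommRing A] [Algebra k A] [Algebra.FiniteType k A] [IsRegularRing A] :
    Algebra.Smooth k A := by
  haveI : Algebra.FinitePresentation k A := (Algebra.FinitePresentation.of_finiteType).mp ‹_›
  have h : Algebra.smoothLocus k A = Set.univ := Set.eq_univ_of_forall fun p =>
    (isSmoothAt_iff_isRegularLocalRing_of_perfectField k A p.asIdeal).mpr inferInstance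
  exact ⟨Algebra.smoothLocus_eq_univ_iff.mp h, inferInstance⟩

/-- **A smooth algebra over a field is a regular ring**: it is Noetherian (of finite type over a
field) and smooth at every prime, hence regular at every prime (EGA IV 17.5.8 (iii),
`isRegularLocalRing_of_isSmoothAt`). [folklore] -/
theorem isRegularRing_of_smooth (k A : Type u) [Field k] [CommRing A] [Algebra k A]
    [Algebra.Smooth k A] : IsRegularRing A := by
  haveI : Algebra.FinitePresentation k A := Algebra.Smooth.finitePresentation
  haveI : IsNoetherianRing A := Algebra.FiniteType.isNoetherianRing k A
  refine isRegularRing_iff.mpr fun p hp => ?_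
  haveI : Algebra.IsSmoothAt k p := by
    have hmem : (⟨p, hp⟩ : PrimeSpectrum A) ∈ Algebra.smoothLocus k A := by
      rw [Algebra.smoothLocus_eq_univ]; trivial
    exact hmem
  exact isRegularLocalRing_of_isSmoothAt k A p

/-- **Over a perfect field, smooth ⟺ regular** for finitely generated algebras.
[cite: Matsumura1987, §30 Remark 2 after Thm. 30.3] -/
theorem smooth_iff_isRegularRing_of_perfectField (k A : Type u) [Field k] [PerfectField k]
    [CommRing A] [Algebra k A] [Algebra.FiniteType k A] :
    Algebra.Smooth k A ↔ IsRegularRing A :=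
  ⟨fun _ => isRegularRing_of_smooth k A, fun _ => smooth_of_isRegularRing_of_perfectField k A⟩

/-! ## The chart rings `(T[It])_{(a t)}`, `a ∈ I`, of the blowing up -/

/-- The chart ring at a generator is of finite type over the ground field: `(T[It])_{(x_i t)}`,
`I = (x_1, …, x_r)`, is generated over `T` by the fractions `(x_j t)/(x_i t)`
(`eval₂Hom_chartGen_surjective`: it is a quotient of `T[X_j : j ≠ i]`), and `T` is of finite type
over `k`. [folklore] -/
theorem finiteType_blowupChart_generator (k T : Type u) [Field k] [CommRing T] [Algebra k T]
    [Algebra.FiniteType k T] {r : ℕ} (x : Fin r → T) (i : Fin r) :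
    ((reesChartBase (x i) (Ideal.mem_span_range_self (f := x) (x := i))).comp
      (algebraMap k T)).FiniteType := by
  -- `φ : T → B` is of finite type: `B` is a quotient of a polynomial ring over `T` in finitely
  -- many variables, compatibly with `φ`
  have key : ∀ {ι : Type} [Finite ι]
      (g : ι → HomogeneousLocalization.Away (reesGrading (Ideal.span (Set.range x)))
        (reesT (x i) (Ideal.mem_span_range_self (f := x) (x := i)))),
      Function.Surjective (MvPolynomial.eval₂Hom
        (reesChartBase (x i) (Ideal.mem_span_range_self (f := x) (x := i))) g) →
      (reesChartBase (x i) (Ideal.mem_span_range_self (f := x) (x := i))).FiniteType := by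
    intro ι _ g hg
    have hC : (MvPolynomial.C : T →+* MvPolynomial ι T).FiniteType := by
      rw [← MvPolynomial.algebraMap_eq]
      exact RingHom.finiteType_algebraMap.mpr inferInstance
    have h3 : (MvPolynomial.eval₂Hom
        (reesChartBase (x i) (Ideal.mem_span_range_self (f := x) (x := i))) g).comp
          MvPolynomial.C =
        reesChartBase (x i) (Ideal.mem_span_range_self (f := x) (x := i)) :=
      RingHom.ext fun t => MvPolynomial.eval₂Hom_C _ _ t
    rw [← h3]
    exact (RingHom.FiniteType.of_surjective _ hg).comp hC
  have hφ := key _ (eval₂Hom_chartGen_surjective x i)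
  exact hφ.comp (RingHom.finiteType_algebraMap.mpr ‹_›)

/-- **The chart rings are of finite type over the ground field**: for `T` of finite type over
`k`, any ideal `I` of `T` and any `a ∈ I`, the chart ring `(T[It])_{(a t)} = T[I/a]` of
`Bl_I(Spec T)` is of finite type over `k` — append `a` to a finite list of generators of `I` and
use the chart at a generator (`finiteType_blowupChart_generator`). [folklore] -/
theorem finiteType_blowupChart (k T : Type u) [Field k] [CommRing T] [Algebra k T]
    [Algebra.FiniteType k T] (I : Ideal T) (a : T) (ha : a ∈ I) :
    ((reesChartBase a ha).comp (algebraMap k T)).FiniteType := by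
  haveI : IsNoetherianRing T := Algebra.FiniteType.isNoetherianRing k T
  -- finitely many generators `g` of `I`, and the generating family `y = (a, g_1, …, g_n)`
  obtain ⟨n, g, hg⟩ := Submodule.fg_iff_exists_fin_generating_family.mp
    (IsNoetherian.noetherian I)
  obtain ⟨s, y, i, hy, hyi⟩ : ∃ (s : ℕ) (y : Fin s → T) (i : Fin s),
      Ideal.span (Set.range y) = I ∧ y i = a := by
    refine ⟨n + 1, Fin.cons a g, 0, le_antisymm ?_ ?_, rfl⟩
    · rw [Ideal.span_le]
      rintro _ ⟨j, rfl⟩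
      refine Fin.cases ?_ (fun j => ?_) j
      · simpa using ha
      · rw [Fin.cons_succ, ← hg]
        exact Submodule.subset_span ⟨j, rfl⟩
    · rw [← hg]
      refine Submodule.span_le.mpr ?_
      rintro _ ⟨j, rfl⟩
      exact Ideal.subset_span ⟨j.succ, by simp⟩
  subst hy
  subst hyi
  exact finiteType_blowupChart_generator k T y i

/-- **Every chart of the blowing up of a regular ring along a quasi-regular centre with regular
quotient is a regular ring**: for `T` regular, `x = (x_1, …, x_r)` quasi-regular with `T/(x)`
regular and ANY `a ∈ I = (x)`, the chart ring `(T[It])_{(a t)}` is regular — `Spec (T[It])_{(a t)}`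
is the affine open `D₊(a t)` of the regular scheme `Bl_I(Spec T)`
(`affineBlowup.isRegular_of_isQuasiRegular`: Liu, Thm. 8.1.19 (a)), open immersions induce
isomorphisms of local rings, and the chart ring is Noetherian (of finite type over
`(T[It])₀ ≅ T`). [cite: Liu2002, Thm. 8.1.19 (a)] -/
theorem isRegularRing_blowupChart_of_mem {T : Type u} [CommRing T] [IsRegularRing T] {r : ℕ}
    (x : Fin r → T) (hx : IsQuasiRegular x) [IsRegularRing (T ⧸ Ideal.span (Set.range x))]
    (a : T) (ha : a ∈ Ideal.span (Set.range x)) :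
    IsRegularRing (HomogeneousLocalization.Away (reesGrading (Ideal.span (Set.range x)))
      (reesT a ha)) := by
  -- the blowing up is a regular scheme and the chart is an open subscheme of it
  have hZ : Scheme.IsRegular (affineBlowup (Ideal.span (Set.range x))) :=
    affineBlowup.isRegular_of_isQuasiRegular x hx
  let j := Proj.awayι (reesGrading (Ideal.span (Set.range x))) (reesT a ha) (reesT_mem a ha)
    Nat.one_pos
  have hU : Scheme.IsRegular (Spec (.of (HomogeneousLocalization.Away
      (reesGrading (Ideal.span (Set.range x))) (reesT a ha)))) := fun y => by
    haveI := hZ (j y)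
    exact IsRegularLocalRing.of_ringEquiv (asIso (j.stalkMap y)).commRingCatIsoToRingEquiv
  -- the chart ring is Noetherian: of finite type over the Noetherian ring `(T[It])₀ ≅ T`
  haveI : IsNoetherianRing (reesGrading (Ideal.span (Set.range x)) 0) :=
    isNoetherianRing_of_ringEquiv T (reesGrading.zeroEquiv (Ideal.span (Set.range x)))
  haveI : Algebra.FiniteType (reesGrading (Ideal.span (Set.range x)) 0)
      (HomogeneousLocalization.Away (reesGrading (Ideal.span (Set.range x))) (reesT a ha)) :=
    HomogeneousLocalization.Away.finiteType (reesT a ha) 1 (reesT_mem a ha)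
  haveI : IsNoetherianRing (HomogeneousLocalization.Away (reesGrading (Ideal.span (Set.range x)))
      (reesT a ha)) :=
    Algebra.FiniteType.isNoetherianRing (reesGrading (Ideal.span (Set.range x)) 0) _
  exact (Scheme.isRegular_Spec_iff (.of (HomogeneousLocalization.Away
    (reesGrading (Ideal.span (Set.range x))) (reesT a ha)))).mp hU

/-- Smoothness of all charts, regular-ring form: `T` regular of finite type over the perfect
field `k`, `x` quasi-regular with `T/(x)` regular, `a ∈ (x)` ⇒ `(T[It])_{(a t)}` smooth over `k`.
[cite: Liu2002, Thm. 8.1.19 (a)] -/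
theorem smooth_blowupChart_of_isRegularRing (k T : Type u) [Field k] [PerfectField k]
    [CommRing T] [Algebra k T] [Algebra.FiniteType k T] [IsRegularRing T] {r : ℕ}
    (x : Fin r → T) (hx : IsQuasiRegular x) [IsRegularRing (T ⧸ Ideal.span (Set.range x))]
    (a : T) (ha : a ∈ Ideal.span (Set.range x)) :
    ((reesChartBase a ha).comp (algebraMap k T)).Smooth := by
  letI := ((reesChartBase a ha).comp (algebraMap k T)).toAlgebra
  haveI := isRegularRing_blowupChart_of_mem x hx a ha
  haveI : Algebra.FiniteType k (HomogeneousLocalization.Away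
      (reesGrading (Ideal.span (Set.range x))) (reesT a ha)) :=
    finiteType_blowupChart k T (Ideal.span (Set.range x)) a ha
  exact smooth_of_isRegularRing_of_perfectField k
    (HomogeneousLocalization.Away (reesGrading (Ideal.span (Set.range x))) (reesT a ha))

/-- **Brick `smooth_blowupChart` (crux `IndSmooth.ValuativeSmoothing`, line `birth`): the
dilatation / blow-up charts of a smooth affine scheme over a perfect field at a regular centre
are smooth.** Let `k` be a perfect field, `T` a smooth `k`-algebra, and `x = (x_1, …, x_r)` a
quasi-regular sequence in `T` (e.g. a `T`-sequence) such that `T/(x)` is a regular ring — a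
regular centre `V(x) ⊆ Spec T`, for instance a closed point cut out by a regular system of
parameters. Then for every `a ∈ I = (x)` the chart ring `T[I/a] = (T[It])_{(a t)}` of the blowing
up `Bl_I(Spec T) = Proj T[It]`, with its `k`-algebra structure through
`reesChartBase a : T → (T[It])_{(a t)}`, is smooth over `k`. Proof: smooth over a field ⇒
regular; the blowing up of a regular ring along a quasi-regular sequence with regular quotient is
a regular scheme (`affineBlowup.isRegular_of_isQuasiRegular`, Liu Thm. 8.1.19 (a)), so its affine
charts are regular rings; they are of finite type over `k`; regular of finite type over a perfect
field ⇒ smooth (Matsumura §30 Remark 2).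
[cite: Liu2002, Thm. 8.1.19 (a)] [cite: Matsumura1987, §30 Remark 2 after Thm. 30.3] -/
theorem smooth_blowupChart (k T : Type) [Field k] [PerfectField k] [CommRing T] [Algebra k T]
    (hT : Algebra.Smooth k T) {r : ℕ} (x : Fin r → T)
    (hx : Literature.AlgebraicGeometry.Resolution.IsQuasiRegular x)
    (hreg : IsRegularRing (T ⧸ Ideal.span (Set.range x))) (a : T)
    (ha : a ∈ Ideal.span (Set.range x)) :
    ((Literature.AlgebraicGeometry.Resolution.reesChartBase a ha).comp
      (algebraMap k T)).Smooth := by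
  haveI := hT
  haveI : Algebra.FinitePresentation k T := Algebra.Smooth.finitePresentation
  haveI : IsRegularRing T := isRegularRing_of_smooth k T
  haveI := hreg
  exact smooth_blowupChart_of_isRegularRing k T x hx a ha

/-- The same for a `T`-sequence `x` (Mathlib's `RingTheory.Sequence.IsWeaklyRegular`; weakly
regular sequences are quasi-regular by Rees' theorem `isQuasiRegular_of_isWeaklyRegular`).
[cite: Liu2002, Thm. 8.1.19 (a)] -/
theorem smooth_blowupChart_of_isWeaklyRegular (k T : Type u) [Field k] [PerfectField k]
    [CommRing T] [Algebra k T] (hT : Algebra.Smooth k T) {r : ℕ} (x : Fin r → T)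
    (hx : RingTheory.Sequence.IsWeaklyRegular T (List.ofFn x))
    (hreg : IsRegularRing (T ⧸ Ideal.span (Set.range x))) (a : T)
    (ha : a ∈ Ideal.span (Set.range x)) :
    ((reesChartBase a ha).comp (algebraMap k T)).Smooth := by
  haveI := hT
  haveI : Algebra.FinitePresentation k T := Algebra.Smooth.finitePresentation
  haveI : IsRegularRing T := isRegularRing_of_smooth k T
  haveI := hreg
  exact smooth_blowupChart_of_isRegularRing k T x (isQuasiRegular_of_isWeaklyRegular x hx) a ha

/-- Transport to an ideal *equal* to the span of the sequence (the charts depend on the ideal,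
not on the chosen generators). [folklore] -/
theorem smooth_blowupChart_of_eq_span (k T : Type u) [Field k] [PerfectField k]
    [CommRing T] [Algebra k T] [Algebra.FiniteType k T] [IsRegularRing T] {r : ℕ}
    (x : Fin r → T) (hx : IsQuasiRegular x) [IsRegularRing (T ⧸ Ideal.span (Set.range x))]
    (J : Ideal T) (hJ : J = Ideal.span (Set.range x)) (a : T) (ha : a ∈ J) :
    ((reesChartBase a ha).comp (algebraMap k T)).Smooth := by
  subst hJ
  exact smooth_blowupChart_of_isRegularRing k T x hx a ha

/-! ## Local form: blowing up a regular centre after shrinking to a neighbourhood -/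

/-- **Locally, the blowing up of a smooth affine `k`-scheme along a regular centre has smooth
charts.** Let `k` be perfect, `T` smooth over `k`, `I` an ideal with `T/I` a regular ring and
`𝔭 ⊇ I` a prime. Then there are `h ∉ 𝔭` and `f_1, …, f_c ∈ I` such that for every localisation
`L = T[1/h]` (with any `k`-algebra structure compatible with `T`): `I L = (f_1, …, f_c)`, the
`f_j` form a quasi-regular sequence in `L`, and EVERY chart ring `(L[I_L t])_{(a t)} = L[I L/a]`,
`a ∈ I L`, of the blowing up of `Spec L` along `I L` is smooth over `k` (the local structure of a
regular centre, `exists_isQuasiRegular_away_of_isRegularRing`, and `smooth_blowupChart`).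
[cite: Liu2002, Thm. 8.1.19 (a)] -/
theorem exists_smooth_blowupChart_of_le (k T : Type u) [Field k] [PerfectField k] [CommRing T]
    [Algebra k T] (hT : Algebra.Smooth k T) (I : Ideal T) (hI : IsRegularRing (T ⧸ I))
    (p : Ideal T) [p.IsPrime] (hIp : I ≤ p) :
    ∃ h : T, h ∉ p ∧ ∃ (c : ℕ) (f : Fin c → T), (∀ j, f j ∈ I) ∧
      ∀ (L : Type u) [CommRing L] [Algebra T L] [IsLocalization.Away h L] [Algebra k L]
        [IsScalarTower k T L],
        Ideal.map (algebraMap T L) I = Ideal.span (Set.range (algebraMap T L ∘ f)) ∧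
        IsQuasiRegular (algebraMap T L ∘ f) ∧
        ∀ (a : L) (ha : a ∈ Ideal.map (algebraMap T L) I),
          ((reesChartBase a ha).comp (algebraMap k L)).Smooth := by
  haveI := hT
  haveI : Algebra.FinitePresentation k T := Algebra.Smooth.finitePresentation
  haveI : IsRegularRing T := isRegularRing_of_smooth k T
  haveI := hI
  obtain ⟨h, hhp, c, f, hfI, H⟩ := exists_isQuasiRegular_away_of_isRegularRing I p hIp
  refine ⟨h, hhp, c, f, hfI, fun L _ _ _ _ _ => ?_⟩
  obtain ⟨hIL, hqr, hL, hLq⟩ := H L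
  refine ⟨hIL, hqr, fun a ha => ?_⟩
  haveI : IsRegularRing L := hL
  haveI : IsRegularRing (L ⧸ Ideal.span (Set.range (algebraMap T L ∘ f))) := by
    rw [← hIL]; exact hLq
  -- `L = T[1/h]` is of finite type over `k` through `T`
  haveI : Algebra.FinitePresentation T L := IsLocalization.Away.finitePresentation h
  haveI : Algebra.FiniteType k L := Algebra.FiniteType.trans (S := T) inferInstance inferInstance
  exact smooth_blowupChart_of_eq_span k L (algebraMap T L ∘ f) hqr _ hIL a ha

/-- A field is a regular ring; hence so is the quotient of a ring by a maximal ideal.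
[folklore] -/
theorem isRegularRing_quotient_of_isMaximal {T : Type u} [CommRing T] (q : Ideal T)
    [q.IsMaximal] : IsRegularRing (T ⧸ q) := by
  -- transport from the residue field `κ(q)`, an honest `Field`
  let e : (T ⧸ q) ≃+* q.ResidueField :=
    RingEquiv.ofBijective _ q.bijective_algebraMap_quotient_residueField
  haveI : IsRegularRing q.ResidueField := inferInstance
  exact IsRegularRing.of_ringEquiv e.symm

/-- **Dilatation charts at a closed point are smooth, locally**: for `T` smooth over the perfect
field `k` and a maximal ideal `𝔮` of `T` (e.g. the centre of a zero-dimensional valuation), there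
are `h ∉ 𝔮` and `f_1, …, f_c ∈ 𝔮` such that over `L = T[1/h]` the point is cut out by the
quasi-regular sequence `f` (`𝔮 L = (f)`) and every chart ring `(L[𝔮_L t])_{(a t)} = L[𝔮 L/a]`,
`a ∈ 𝔮 L`, of the blowing up of `Spec L` at the closed point `𝔮 L` is smooth over `k` (Liu,
Thm. 8.1.19 (a) at a closed point; Görtz–Wedhorn, Example 13.95).
[cite: Liu2002, Thm. 8.1.19 (a)] -/
theorem exists_smooth_blowupChart_of_isMaximal (k T : Type u) [Field k] [PerfectField k]
    [CommRing T] [Algebra k T] (hT : Algebra.Smooth k T) (q : Ideal T) [q.IsMaximal] :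
    ∃ h : T, h ∉ q ∧ ∃ (c : ℕ) (f : Fin c → T), (∀ j, f j ∈ q) ∧
      ∀ (L : Type u) [CommRing L] [Algebra T L] [IsLocalization.Away h L] [Algebra k L]
        [IsScalarTower k T L],
        Ideal.map (algebraMap T L) q = Ideal.span (Set.range (algebraMap T L ∘ f)) ∧
        IsQuasiRegular (algebraMap T L ∘ f) ∧
        ∀ (a : L) (ha : a ∈ Ideal.map (algebraMap T L) q),
          ((reesChartBase a ha).comp (algebraMap k L)).Smooth :=
  exists_smooth_blowupChart_of_le k T hT q (isRegularRing_quotient_of_isMaximal q) q le_rfl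

end Summit.ResolutionOfSingularities.ResolutionOfSingularities.Theorems.ValuativeSmoothing

end
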